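import Mathlib
import HarnessLib
import Literature.Topology.FourManifolds.SPC4Wave0
import Literature.AlgebraicTopology.SingularHomology.SingularChains
import Literature.Geometry.Kaehler.ManifoldFormsPullback
import Literature.Geometry.Symplectic.SteinDomain
import Literature.Geometry.Symplectic.SteinLiouvilleField
import Literature.Topology.FourManifolds.RegularLevelSplitting
import Literature.Geometry.Symplectic.McleanDivisorComplementConvexFour

/-! # Stub `stub_liouvillePackaging` of line `canonical-cap-filling` for crux `NoGenusTwoDoor`
(stmt-SmoothPoincare4-7842, route SymplecticOrigami) — CLOSED MODULO NAMED FACTS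

**Statement (S3, Liouville packaging).** Let `(N, s)` be a closed connected symplectic
`4`-manifold (`s : MForm`, chartwise smooth, closed, pointwise non-degenerate), `B = b(S)` a
smoothly embedded compact connected `s`-symplectic surface, `U = N ∖ B`, and suppose `s|_U = dθ`
is exact.  Then for every open `V ⊇ B` there are a compact connected Liouville domain `(W, λ)`
in the tree's sense (`Literature.Geometry.Symplectic.IsLiouvilleDomain`: `λ` smooth, `dλ`
non-degenerate, Liouville field transversally outward along `∂W`) and an injective immersion
`ι : W → N` with `N ∖ V ⊆ ι(W) ⊆ N ∖ B` and `dλ = ι^* s`.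

**What is proved here.** `stub_liouvillePackaging_of_mclean`: the registered signature of
`stub_liouvillePackaging`, verbatim, from three named facts stated below in the tree's
vocabulary and in general (not door-specific) form —
* `mclean_divisorComplement_convex_four` (McLean 2012, Lemma 5.17; Diogo–Lisi 2019, Lemma 2.2):
  the exact complement `U` of a closed symplectic surface carries a FINITE-TYPE CONVEX SYMPLECTIC
  STRUCTURE — a smooth primitive `λ` of `s|_U` and a smooth exhausting `g : U → ℝ` whose high
  levels are transverse to the Liouville field `X` of `λ` (`dg(X) > 0` on `{g ≥ C}`);
* `isConnected_compl_range_of_isSmoothEmbedding` (Kosinski 1993, X.1): the complement of a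
  compact smoothly embedded submanifold of codimension `≥ 2` of a connected manifold is
  connected (and nonempty);
* `isPreconnected_sublevel_of_forall_mfderiv_ne_zero` (Milnor 1963, Thm. 3.1): on a connected
  manifold, the sublevel sets `{g ≤ c}`, `c ≥ C`, of a smooth exhausting function without
  critical points on `{g ≥ C}` are connected.

**Proof.** Given `V`, choose a level `c ≥ C` of `g` above `g(x₀)` for some `x₀ ∈ U` and above
`max g` on the compact set `N ∖ V ⊆ U`.  Every `x` with `g x ≥ C` carries a Liouville vector
`X_x` (`dλ_x = s_x` is non-degenerate, so `v ↦ dλ_x(v, ·)` is onto, `exists_forall_apply_vecCons_eq`)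
with `dg(X_x) > 0`, so `c` is a regular level and `W := {g ≤ c}` is the tree's regular sublevel
set `Literature.Topology.FourManifolds.RegularSublevel` (Milnor's Thm. 3.1 in the tree: a
compact `𝓡∂ 4`-manifold with boundary `{g = c}`, the inclusion a smooth embedding with
invertible differential); it is compact (`g` exhausting) and connected (the two topological
facts).  Put `λ_W := ι^*λ`, `ι := (U ⊆ N) ∘ (W ⊆ U)`: `λ_W` is smooth and `dλ_W = ι^*dλ = ι^*s`
(naturality of `d`, `Literature.Geometry.Kaehler.ManifoldFormsPullback`); `dλ_W` is
non-degenerate because `dι` is bijective; and at a boundary point `p` the Liouville vector `v`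
of `λ_W` maps to `X_{ι p}`, so `dg(dι v) > 0`, while in the preferred boundary chart of `W`
(whose `0`-th coordinate is `c - g`) `d(g ∘ ι)_p v = -v₀` (`mfderiv_comp_incl_apply_of_eq`):
hence `v₀ < 0`, i.e. the Liouville field points out of `W`, as `IsLiouvilleDomain` demands.

Sources: McLean, GAFA 22 (2012) = arXiv:1011.2542, §2.1, §4.1, Lemma 5.17; Diogo–Lisi, J. Topol.
12 (2019), §2.1, Lemma 2.2; McDuff–Salamon (2017), Thm. 3.4.10; Milnor, *Morse theory* (1963),
Thm. 3.1; Kosinski (1993), X.1; Cieliebak–Eliashberg (2012), §11.1 (Liouville domains).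
-/

noncomputable section
set_option linter.dupNamespace false
open scoped _root_.Manifold _root_.ContDiff _root_.Topology _root_.ContinuousMap
open _root_.Set _root_.Function _root_.TopologicalSpace
open Literature.Geometry.Kaehler (MForm IsSmoothForm IsClosedForm mextDeriv)
open Literature.AlgebraicTopology.SingularHomology
open Literature.Topology.FourManifolds (singularHomologyZ)
open Literature.Topology.FourManifolds (IsRegularLevel RegularSublevel HalfSliceAtlas)
open Literature.Topology.FourManifolds (isRegularLevel_of_not_isMCriticalPt)
open Literature.Topology.FourManifolds (sublevelAtlas'_datum_apply_zero_of_eq)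
open Literature.Geometry.Symplectic (alt2Flat alt2Flat_apply alt1ToCLM alt1ToCLM_apply)
open Literature.Geometry.Symplectic (exists_continuousLinearEquiv_eq_of_injective)

namespace Summit.SmoothPoincare4.SmoothPoincare4.Theorems.NoGenusTwoDoor.CanonicalCapFilling

/-! ### The named facts -/

/-- **The Liouville vector exists**: for a `2`-form `Ω` on `ℝ⁴` which is non-degenerate
(`Ω(v, ·) = 0 ⇒ v = 0`) and any `1`-form `Λ` there is `Z` with `Ω(Z, ·) = Λ` — the flat map
`v ↦ Ω(v, ·)` (`Literature.Geometry.Symplectic.alt2Flat`) is injective, hence onto by the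
dimension count `dim E = dim E^*`. [folklore] -/
theorem exists_forall_apply_vecCons_eq
    (Ω : (EuclideanSpace ℝ (Fin 4)) [⋀^Fin 2]→L[ℝ] ℝ) (Λ : (EuclideanSpace ℝ (Fin 4)) [⋀^Fin 1]→L[ℝ] ℝ)
    (hΩ : ∀ v, (∀ w, Ω ![v, w] = 0) → v = 0) :
    ∃ Z : EuclideanSpace ℝ (Fin 4), ∀ w, Ω ![Z, w] = Λ ![w] := by
  have hinj : Function.Injective (alt2Flat Ω) := by
    intro v v' h
    have h0 : ∀ w, Ω ![v - v', w] = 0 := fun w => by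
      have h1 : alt2Flat Ω (v - v') = 0 := by rw [map_sub, h, sub_self]
      have h2 := congrArg (fun A : EuclideanSpace ℝ (Fin 4) →L[ℝ] ℝ => A w) h1
      rw [alt2Flat_apply] at h2
      exact h2
    exact sub_eq_zero.1 (hΩ _ h0)
  obtain ⟨e, he⟩ := exists_continuousLinearEquiv_eq_of_injective hinj
  refine ⟨e.symm (alt1ToCLM Λ), fun w => ?_⟩
  have h1 : alt2Flat Ω (e.symm (alt1ToCLM Λ)) = alt1ToCLM Λ := by
    rw [← he]; exact e.apply_symm_apply _
  have h2 := congrArg (fun A : EuclideanSpace ℝ (Fin 4) →L[ℝ] ℝ => A w) h1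
  simpa only [alt2Flat_apply, alt1ToCLM_apply] using h2

/-! ### The boundary of a regular sublevel set: `d(f|)` is minus the `0`-th coordinate -/

/-- **The inward normal coordinate of a regular sublevel set.** At a boundary point `p` of the
regular sublevel set `Mᵃ = {f ≤ a}` (Milnor 1963, Thm. 3.1, the tree's
`Literature.Topology.FourManifolds.RegularSublevel`), whose preferred half-slice chart has
`0`-th coordinate `a - f`, the differential of `f|Mᵃ` is minus the `0`-th coordinate functional:
`d(f ∘ ι)_p v = -v₀`.  So a tangent vector along which `f` increases has negative `0`-th
component, the "outward" convention of `Literature.Geometry.Symplectic.IsLiouvilleDomain`.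
[folklore] -/
theorem mfderiv_comp_incl_apply_of_eq {k : ℕ} {M : Type} [TopologicalSpace M]
    [ChartedSpace (EuclideanSpace ℝ (Fin (k + 1))) M] [IsManifold (𝓡 (k + 1)) ∞ M] {f : M → ℝ}
    {a : ℝ} (h : IsRegularLevel (𝓡 (k + 1)) f a) (p : RegularSublevel h)
    (hp : f (RegularSublevel.incl h p) = a) (v : EuclideanSpace ℝ (Fin (k + 1))) :
    (mfderiv (𝓡∂ (k + 1)) 𝓘(ℝ, ℝ) (f ∘ RegularSublevel.incl h) p v : ℝ) = -(v 0) := by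
  set Φ := RegularSublevel.halfSliceAtlas h
  have hps : p.1 ∈ (Φ.datum p).Θ.source := Φ.mem_source p
  -- in the chart at `p`, `f` reads `a - z₀`
  have hev : (f ∘ (Φ.datum p).Θ.symm) =ᶠ[𝓝 ((Φ.datum p).Θ p.1)]
      fun z : EuclideanSpace ℝ (Fin (k + 1)) => a - z 0 := by
    filter_upwards [(Φ.datum p).Θ.open_target.mem_nhds ((Φ.datum p).Θ.map_source hps)]
      with z hz
    have hq : (Φ.datum p).Θ.symm z ∈ (Φ.datum p).Θ.source := (Φ.datum p).Θ.map_target hz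
    have h0 := sublevelAtlas'_datum_apply_zero_of_eq h.contMDiff a
      (fun _ hq => h.not_isMCriticalPt hq) p hp hq
    have h1 : (Φ.datum p).Θ ((Φ.datum p).Θ.symm z) = z := (Φ.datum p).Θ.right_inv hz
    change (Φ.datum p).Θ ((Φ.datum p).Θ.symm z) 0 = a - f ((Φ.datum p).Θ.symm z) at h0
    simp only [Function.comp_apply]
    rw [h1] at h0
    linarith
  have h0d : HasFDerivAt (fun z : EuclideanSpace ℝ (Fin (k + 1)) => z 0)
      (EuclideanSpace.proj (0 : Fin (k + 1)) : EuclideanSpace ℝ (Fin (k + 1)) →L[ℝ] ℝ)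
      ((Φ.datum p).Θ p.1) :=
    (EuclideanSpace.proj (0 : Fin (k + 1)) : EuclideanSpace ℝ (Fin (k + 1)) →L[ℝ] ℝ).hasFDerivAt
  have h1d : HasFDerivAt (fun z : EuclideanSpace ℝ (Fin (k + 1)) => a - z 0)
      (-(EuclideanSpace.proj (0 : Fin (k + 1)) : EuclideanSpace ℝ (Fin (k + 1)) →L[ℝ] ℝ))
      ((Φ.datum p).Θ p.1) :=
    h0d.const_sub a
  have hF : DifferentiableAt ℝ (f ∘ (Φ.datum p).Θ.symm) ((Φ.datum p).Θ p.1) :=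
    (h1d.differentiableAt).congr_of_eventuallyEq hev
  have hFS : MDifferentiableAt (𝓡∂ (k + 1)) 𝓘(ℝ, ℝ) (f ∘ RegularSublevel.incl h) p :=
    (h.contMDiff.comp (RegularSublevel.contMDiff_incl h)).mdifferentiableAt (by simp)
  -- the manifold derivative of `f|` is read in the half-slice chart
  have key : mfderiv (𝓡∂ (k + 1)) 𝓘(ℝ, ℝ) (f ∘ RegularSublevel.incl h) p =
      fderiv ℝ (f ∘ (Φ.datum p).Θ.symm) ((Φ.datum p).Θ p.1) :=
    Φ.mfderiv_comp_val_eq f p hFS hF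
  rw [key, hev.fderiv_eq, h1d.fderiv]
  rfl

/-! ### The stub, closed modulo the named facts -/

/-- **STUB S3 (Liouville packaging), conditional form.** Assuming the named facts
`mclean_divisorComplement_convex_four` (McLean 2012 / Diogo–Lisi 2019),
`isConnected_compl_range_of_isSmoothEmbedding` (Kosinski 1993) and
`isPreconnected_sublevel_of_forall_mfderiv_ne_zero` (Milnor 1963): for a closed connected
symplectic `(N, s)`, a smoothly embedded compact connected `s`-symplectic surface `B = b(S)`
with `s` exact on `U = N ∖ B`, and every open `V ⊇ B`, there is a compact connected Liouville
domain `(W, λ)` with an injective immersion `ι : W → N`, `N ∖ V ⊆ ι(W) ⊆ N ∖ B`, `dλ = ι^* s`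
— the registered signature of `stub_liouvillePackaging`, verbatim, as conclusion.  `W` is the
regular sublevel set `{g ≤ c}` of McLean's exhausting function at a high level, `λ` the
restriction of McLean's primitive; proof in the module docstring.
[cite: Mclean2012, Lemma 5.17] -/
theorem stub_liouvillePackaging_of_mclean :
    Literature.Geometry.Symplectic.mclean_divisorComplement_convex_four →
    Literature.Geometry.Symplectic.isConnected_compl_range_of_isSmoothEmbedding →
    Literature.Geometry.Symplectic.isPreconnected_sublevel_of_forall_mfderiv_ne_zero →
    ∀ (N : Type) [TopologicalSpace N] [T2Space N] [SecondCountableTopology N] [CompactSpace N]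
      [ConnectedSpace N] [ChartedSpace (EuclideanSpace ℝ (Fin 4)) N] [IsManifold (𝓡 4) ∞ N]
      (s : MForm (𝓡 4) N ℝ 2)
      (S : Type) [TopologicalSpace S] [T2Space S] [CompactSpace S] [ConnectedSpace S]
      [ChartedSpace (EuclideanSpace ℝ (Fin 2)) S] [IsManifold (𝓡 2) ∞ S] (b : S → N)
      (U : Opens N),
      IsSmoothForm s → IsClosedForm s →
      (∀ x (v : TangentSpace (𝓡 4) x), v ≠ 0 → ∃ w, s x ![v, w] ≠ 0) →
      Manifold.IsSmoothEmbedding (𝓡 2) (𝓡 4) ∞ b →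
      (∀ y (v : TangentSpace (𝓡 2) y), v ≠ 0 → ∃ w : TangentSpace (𝓡 2) y,
        s (b y) ![mfderiv (𝓡 2) (𝓡 4) b y v, mfderiv (𝓡 2) (𝓡 4) b y w] ≠ 0) →
      (U : Set N) = (Set.range b)ᶜ →
      (∃ θ : MForm (𝓡 4) U ℝ 1, IsSmoothForm θ ∧
        mextDeriv θ = s.pullback (𝓡 4) (Subtype.val : U → N)) →
      ∀ V : Set N, IsOpen V → Set.range b ⊆ V →
        ∃ (W : Type) (_ : TopologicalSpace W) (_ : T2Space W) (_ : SecondCountableTopology W)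
          (_ : CompactSpace W) (_ : ConnectedSpace W) (_ : ChartedSpace (EuclideanHalfSpace 4) W)
          (_ : IsManifold (𝓡∂ 4) ∞ W) (lam : MForm (𝓡∂ 4) W ℝ 1) (ι : W → N),
          Literature.Geometry.Symplectic.IsLiouvilleDomain W lam ∧
          ContMDiff (𝓡∂ 4) (𝓡 4) ∞ ι ∧ Function.Injective ι ∧
          (∀ x, Function.Injective (mfderiv (𝓡∂ 4) (𝓡 4) ι x)) ∧
          Set.range ι ⊆ (Set.range b)ᶜ ∧ Vᶜ ⊆ Set.range ι ∧
          mextDeriv lam = s.pullback (𝓡∂ 4) ι := by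
  intro hML hKos hMil N _ _ _ _ _ _ _ s S _ _ _ _ _ _ b U hs hcl hnd hb hbnd hU hex V hV hBV
  obtain ⟨lam, g, C, hlam, hdlam, hg, hcpt, hconv⟩ :=
    hML N s S b U hs hcl hnd hb hbnd hU hex
  -- (1) `U` is connected and nonempty (codimension two)
  have hUc : IsConnected (U : Set N) := by
    rw [hU]; exact hKos 2 4 N S b (by norm_num) hb
  haveI hUconn : ConnectedSpace U := isConnected_iff_connectedSpace.1 hUc
  obtain ⟨x₀⟩ : Nonempty U := inferInstance
  -- (2) `dλ = s|_U` is non-degenerate, so there are Liouville vectors: no critical point above `C`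
  have hnd' : ∀ (x : U) (v : EuclideanSpace ℝ (Fin 4)),
      (∀ w : EuclideanSpace ℝ (Fin 4), mextDeriv lam x ![v, w] = 0) → v = 0 := by
    intro x v hv
    by_contra hv0
    obtain ⟨w, hw⟩ := hnd x.1 v hv0
    apply hw
    have h1 := hv w
    rwa [hdlam, Literature.Geometry.Kaehler.MForm.pullback_subtypeVal_apply] at h1
  have hreg : ∀ x : U, C ≤ g x → mfderiv (𝓡 4) 𝓘(ℝ, ℝ) g x ≠ 0 := by
    intro x hx h0
    obtain ⟨Z, hZ⟩ := exists_forall_apply_vecCons_eq (mextDeriv lam x) (lam x) (hnd' x)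
    have h1 := hconv x hx Z hZ
    have h2 : mfderiv (𝓡 4) 𝓘(ℝ, ℝ) g x Z = (0 : ℝ) := by rw [h0]; rfl
    rw [h2] at h1
    exact lt_irrefl _ h1
  -- (3) the level `c`: above `C`, above `g x₀`, above `g` on the compact `U ∖ V`
  set K : Set U := (Subtype.val : U → N) ⁻¹' Vᶜ with hK
  have hKc : IsCompact K := by
    rw [Topology.IsEmbedding.subtypeVal.isCompact_iff]
    have hKim : (Subtype.val : U → N) '' K = Vᶜ := by
      rw [hK, image_preimage_eq_inter_range, Subtype.range_coe_subtype]
      refine inter_eq_left.2 fun y hy => ?_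
      show y ∈ (U : Set N)
      exact hU ▸ fun hyb => hy (hBV hyb)
    rw [hKim]
    exact hV.isClosed_compl.isCompact
  obtain ⟨B, hB⟩ := hKc.bddAbove_image hg.continuous.continuousOn
  set c : ℝ := max (max C (g x₀)) B
  have hCc : C ≤ c := (le_max_left _ _).trans (le_max_left _ _)
  have hx₀c : g x₀ ≤ c := (le_max_right _ _).trans (le_max_left _ _)
  have hKle : ∀ y ∈ K, g y ≤ c := fun y hy =>
    (hB (mem_image_of_mem g hy)).trans (le_max_right _ _)
  have hlev : IsRegularLevel (𝓡 4) g c :=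
    isRegularLevel_of_not_isMCriticalPt (k := 3) hg fun x hx => hreg x (hx ▸ hCc)
  -- (4) the domain `W = {g ≤ c}`: compact, connected, smoothly included with invertible `dι`
  haveI hWcpt : CompactSpace (RegularSublevel hlev) := isCompact_iff_compactSpace.1 (hcpt c)
  have hWconn : ConnectedSpace (RegularSublevel hlev) :=
    isConnected_iff_connectedSpace.1 ⟨⟨x₀, hx₀c⟩, hMil 4 U g C hg hcpt hreg c hCc⟩
  set incl := RegularSublevel.incl hlev with hincl_def
  have hincl : ContMDiff (𝓡∂ 4) (𝓡 4) ∞ incl := RegularSublevel.contMDiff_incl hlev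
  have hval : ContMDiff (𝓡 4) (𝓡 4) ∞ (Subtype.val : U → N) := contMDiff_subtype_val
  have hD : ∀ p, Function.Bijective (mfderiv (𝓡∂ 4) (𝓡 4) incl p) := fun p => by
    have h1 := RegularSublevel.det_mfderiv_incl_ne_zero hlev p
    set F : EuclideanSpace ℝ (Fin (3 + 1)) →ₗ[ℝ] EuclideanSpace ℝ (Fin (3 + 1)) :=
      (mfderiv (𝓡∂ (3 + 1)) (𝓡 (3 + 1)) (RegularSublevel.incl hlev) p).toLinearMap with hF
    have h2 := (LinearMap.isUnit_iff_isUnit_det F).2 (isUnit_iff_ne_zero.2 h1)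
    exact (Module.End.isUnit_iff F).1 h2
  -- (5) the Liouville form `λ_W = ι^* λ` and the map `ι`
  set lamW : MForm (𝓡∂ 4) (RegularSublevel hlev) ℝ 1 := lam.pullback (𝓡∂ 4) incl with hlamW_def
  set ι : RegularSublevel hlev → N := Subtype.val ∘ incl with hι_def
  have hι : ContMDiff (𝓡∂ 4) (𝓡 4) ∞ ι := hval.comp hincl
  have hlamW : IsSmoothForm lamW :=
    Literature.NumberTheory.Transcendental.isSmoothForm_pullback hincl hlam
  have hdlamW : mextDeriv lamW = (mextDeriv lam).pullback (𝓡∂ 4) incl :=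
    Literature.NumberTheory.Transcendental.mextDeriv_pullback hincl hlam
  have hdW : ∀ (p : RegularSublevel hlev) (v w : EuclideanSpace ℝ (Fin 4)),
      mextDeriv lamW p ![v, w] = mextDeriv lam (incl p)
        ![mfderiv (𝓡∂ 4) (𝓡 4) incl p v, mfderiv (𝓡∂ 4) (𝓡 4) incl p w] := by
    intro p v w
    rw [hdlamW, Literature.Geometry.Kaehler.MForm.pullback_apply]
    exact congrArg _ (funext fun i => by fin_cases i <;> rfl)
  have hW1 : ∀ (p : RegularSublevel hlev) (w : EuclideanSpace ℝ (Fin 4)),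
      lamW p ![w] = lam (incl p) ![mfderiv (𝓡∂ 4) (𝓡 4) incl p w] := by
    intro p w
    rw [hlamW_def, Literature.Geometry.Kaehler.MForm.pullback_apply]
    exact congrArg _ (funext fun i => by fin_cases i; rfl)
  refine ⟨RegularSublevel hlev, inferInstance, inferInstance, inferInstance, hWcpt, hWconn,
    inferInstance, inferInstance, lamW, ι, ⟨hlamW, ?_, ?_⟩, hι, ?_, ?_, ?_, ?_, ?_⟩
  · -- `dλ_W` is non-degenerate
    intro p v hv
    have h1 : ∀ w', mextDeriv lam (incl p) ![mfderiv (𝓡∂ 4) (𝓡 4) incl p v, w'] = 0 := by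
      intro w'
      obtain ⟨w, rfl⟩ := (hD p).2 w'
      rw [← hdW]
      exact hv w
    exact (map_eq_zero_iff _ (hD p).1).1 (hnd' (incl p) _ h1)
  · -- the Liouville field points out of `W` along `∂W = {g = c}`
    intro p hp v hv
    have hpc : g (incl p) = c := (RegularSublevel.isBoundaryPoint_iff hlev p).1 hp
    have hCp : C ≤ g (incl p) := by rw [hpc]; exact hCc
    have h1 : ∀ w', mextDeriv lam (incl p) ![mfderiv (𝓡∂ 4) (𝓡 4) incl p v, w'] =
        lam (incl p) ![w'] := by
      intro w'
      obtain ⟨w, rfl⟩ := (hD p).2 w'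
      rw [← hdW, ← hW1]
      exact hv w
    have h3 : (0 : ℝ) < mfderiv (𝓡 4) 𝓘(ℝ, ℝ) g (incl p) (mfderiv (𝓡∂ 4) (𝓡 4) incl p v) :=
      hconv (incl p) hCp _ h1
    have h4 : (mfderiv (𝓡∂ 4) 𝓘(ℝ, ℝ) (g ∘ incl) p v : ℝ) =
        mfderiv (𝓡 4) 𝓘(ℝ, ℝ) g (incl p) (mfderiv (𝓡∂ 4) (𝓡 4) incl p v) := by
      rw [mfderiv_comp p (hg.mdifferentiableAt (by simp)) (hincl.mdifferentiableAt (by simp))]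
      rfl
    have h5 : (mfderiv (𝓡∂ 4) 𝓘(ℝ, ℝ) (g ∘ incl) p v : ℝ) = -(v 0) :=
      mfderiv_comp_incl_apply_of_eq hlev p hpc v
    have h6 : (0 : ℝ) < -(v 0) := by rw [← h5, h4]; exact h3
    exact neg_pos.1 h6
  · -- `ι` is injective
    exact Subtype.val_injective.comp (RegularSublevel.injective_incl hlev)
  · -- `dι` is injective
    intro p
    have hvu : ∀ u : TangentSpace (𝓡 4) (incl p),
        mfderiv (𝓡 4) (𝓡 4) (Subtype.val : U → N) (incl p) u = u := fun u => by
      rw [Literature.Geometry.Manifold.OpenSubmanifold.mfderiv_subtype_val]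
      rfl
    have hcomp : ∀ u : TangentSpace (𝓡∂ 4) p, mfderiv (𝓡∂ 4) (𝓡 4) ι p u =
        mfderiv (𝓡 4) (𝓡 4) (Subtype.val : U → N) (incl p) (mfderiv (𝓡∂ 4) (𝓡 4) incl p u) := by
      intro u
      rw [hι_def, mfderiv_comp p (hval.mdifferentiableAt (by simp)) (hincl.mdifferentiableAt (by simp))]
      rfl
    intro v w hvw
    rw [hcomp, hcomp, hvu, hvu] at hvw
    exact (hD p).1 hvw
  · -- `ι(W) ⊆ N ∖ B`
    rintro _ ⟨p, rfl⟩
    exact hU ▸ (incl p).2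
  · -- `N ∖ V ⊆ ι(W)`
    intro y hy
    have hyU : y ∈ (U : Set N) := hU ▸ fun hyb => hy (hBV hyb)
    exact ⟨RegularSublevel.mk hlev ⟨y, hyU⟩ (hKle ⟨y, hyU⟩ hy), rfl⟩
  · -- `dλ_W = ι^* s`
    rw [hdlamW, hdlam, hι_def]
    exact (Literature.Geometry.Kaehler.MForm.pullback_comp (hval.mdifferentiable (by simp))
      (hincl.mdifferentiable (by simp)) s).symm

end Summit.SmoothPoincare4.SmoothPoincare4.Theorems.NoGenusTwoDoor.CanonicalCapFilling
end
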